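import Mathlib
import Literature.AlgebraicGeometry.Resolution.ValuationDefect
import Literature.AlgebraicGeometry.Resolution.FundamentalInequality
import HarnessLib

/-!
# Route `RadicialJung`, crux `CleanModels` (stmt-15917), stub `stub_cleanLU3Defect`: the valuation ring of a purely inseparable
# extension of height one, and valuation independence of the products `aᵢ bⱼ` (valuation theory, part 1 of 2)

Line `Sketch` rev 17 of crux stmt-ResolutionOfSingularities-15917; lead `res-B-lead-1` g2.  OURS; nothing here proves resolution in
characteristic `p`.

Setting: `K ⊆ L` fields of characteristic `p` with `L^p ⊆ K` (a purely inseparable extension of height one, e.g. `L = K(g₀^{1/p})`),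
`O = K°` a valuation ring of `K`.  Then `O` has exactly ONE extension to `L`, `O' = {ξ : ξ^p ∈ O}` (`exists_valuationSubring_comap_eq`,
`eq_of_comap_eq`; no definition is introduced — users quantify over `O'` with `O' ∩ K = O`).
If `(K, O)` is DEFECTLESS in `L` (`IsDefectlessIn`: `e · f = [L : K]` for the ramification index and inertia degree of `O'/O`),
then — the classical «valuation basis» argument (Zariski–Samuel VI §11; Kuhlmann 2010 §1): products `aᵢ bⱼ` of coset
representatives of `|L^×|/|K^×|` (with `a₁ = 1`) and lifts of a residue basis (with `b₁ = 1`) form a VALUATION-INDEPENDENT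
`K`-basis of `L` — every `θ ∈ L ∖ K` has a BEST APPROXIMATION from `K`: some `f₀ ∈ K` with `v'(θ - f₀) ≤ v'(θ - f)` for all
`f ∈ K` (multiplicative convention, `exists_isMin_approx_of_isDefectlessIn`).  With `θ^p = g₀` this is a best `p`-th-power
approximation of `g₀` (`(θ - f)^p = g₀ - f^p`), the hypothesis of ✓ `cleanLU3_of_isMin_pthPowerApprox` (p677129); the
companion file `…CleanLU3Abhyankar.lean` feeds it with Kuhlmann's generalized stability theorem (✓ `Kuhlmann2010Stability_holds`).
-/

noncomputable section

set_option linter.dupNamespace false -- mandated namespace of this single-conjunct summit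

open IsLocalRing
open Literature.AlgebraicGeometry.Resolution

namespace Summit.ResolutionOfSingularities.ResolutionOfSingularities.Theorems.RadicialJung.CleanModels

universe u

variable {K L : Type u} [Field K] [Field L] [Algebra K L] {p : ℕ} [hp : Fact p.Prime] [CharP L p]

/-! ## The unique extension of a valuation ring along a purely inseparable extension of height one -/

omit [CharP L p] in
/-- In a valuation ring, `ξ^p ∈ O'' ↔ ξ ∈ O''`. [folklore] -/
theorem pow_mem_valuationSubring_iff (O'' : ValuationSubring L) (ξ : L) : ξ ^ p ∈ O'' ↔ ξ ∈ O'' := by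
  rw [← O''.valuation_le_one_iff, ← O''.valuation_le_one_iff, map_pow]
  exact pow_le_one_iff_of_nonneg zero_le hp.out.ne_zero

/-- **Existence of an extension**: for `L ⊇ K` with `L^p ⊆ K`, the set `{ξ ∈ L : ξ^p ∈ O}` is a valuation ring of `L` lying over the
valuation ring `O` of `K`. [folklore] -/
theorem exists_valuationSubring_comap_eq (O : ValuationSubring K) (hpow : ∀ ξ : L, ∃ c : K, algebraMap K L c = ξ ^ p) :
    ∃ O' : ValuationSubring L, O'.comap (algebraMap K L) = O := by
  let O' : ValuationSubring L :=
    { carrier := {ξ | ∃ c : K, c ∈ O ∧ algebraMap K L c = ξ ^ p}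
      mul_mem' := by
        rintro ξ η ⟨c, hc, hcξ⟩ ⟨d, hd, hdη⟩
        exact ⟨c * d, O.mul_mem _ _ hc hd, by rw [map_mul, hcξ, hdη, mul_pow]⟩
      one_mem' := ⟨1, O.one_mem, by rw [map_one, one_pow]⟩
      add_mem' := by
        rintro ξ η ⟨c, hc, hcξ⟩ ⟨d, hd, hdη⟩
        exact ⟨c + d, O.add_mem _ _ hc hd, by rw [map_add, hcξ, hdη, add_pow_char]⟩
      zero_mem' := ⟨0, O.zero_mem, by rw [map_zero, zero_pow hp.out.ne_zero]⟩
      neg_mem' := by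
        rintro ξ ⟨c, hc, hcξ⟩
        exact ⟨-c, O.neg_mem _ hc, by rw [map_neg, hcξ, neg_pow, neg_one_pow_char, neg_one_mul]⟩
      mem_or_inv_mem' := by
        intro ξ
        obtain ⟨c, hcξ⟩ := hpow ξ
        rcases O.mem_or_inv_mem c with hc | hc
        · exact Or.inl ⟨c, hc, hcξ⟩
        · exact Or.inr ⟨c⁻¹, hc, by rw [map_inv₀, hcξ, inv_pow]⟩ }
  refine ⟨O', ?_⟩
  ext c
  change (∃ d : K, d ∈ O ∧ algebraMap K L d = (algebraMap K L c) ^ p) ↔ c ∈ O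
  constructor
  · rintro ⟨d, hd, hdc⟩
    rw [← map_pow] at hdc
    have hdc' : d = c ^ p := (algebraMap K L).injective hdc
    rw [hdc'] at hd
    rw [← O.valuation_le_one_iff] at hd ⊢
    rw [map_pow] at hd
    exact (pow_le_one_iff_of_nonneg zero_le hp.out.ne_zero).mp hd
  · intro hc
    exact ⟨c ^ p, O.pow_mem hc _, map_pow _ _ _⟩

omit [CharP L p] in
/-- Membership in an extension `O'` of `O` along `L^p ⊆ K`: `ξ ∈ O' ↔ ξ^p ∈ O`. [folklore] -/
theorem mem_iff_of_comap_eq (O : ValuationSubring K) (hpow : ∀ ξ : L, ∃ c : K, algebraMap K L c = ξ ^ p)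
    (O' : ValuationSubring L) (hO' : O'.comap (algebraMap K L) = O) (ξ : L) :
    ξ ∈ O' ↔ ∃ c : K, c ∈ O ∧ algebraMap K L c = ξ ^ p := by
  obtain ⟨c, hc⟩ := hpow ξ
  have hcO : c ∈ O ↔ algebraMap K L c ∈ O' := by rw [← hO']; rfl
  rw [← pow_mem_valuationSubring_iff (p := p) O' ξ]
  constructor
  · intro hmem
    rw [← hc] at hmem
    exact ⟨c, hcO.mpr hmem, hc⟩
  · rintro ⟨d, hd, hdc⟩
    have : d = c := (algebraMap K L).injective (hdc.trans hc.symm)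
    rw [this] at hd
    rw [← hc]
    exact hcO.mp hd

omit [CharP L p] in
/-- **Uniqueness of the extension** along `L^p ⊆ K`. [folklore] -/
theorem eq_of_comap_eq (O : ValuationSubring K) (hpow : ∀ ξ : L, ∃ c : K, algebraMap K L c = ξ ^ p)
    (O₁ O₂ : ValuationSubring L) (h₁ : O₁.comap (algebraMap K L) = O) (h₂ : O₂.comap (algebraMap K L) = O) : O₁ = O₂ := by
  ext ξ
  rw [mem_iff_of_comap_eq O hpow O₁ h₁, mem_iff_of_comap_eq O hpow O₂ h₂]

omit [CharP L p] in
/-- **Defectless ⟹ `e · f = [L : K]`** for the (unique) extension `O'`. [cite: Kuhlmann2010, Section 1 (p. 3)] -/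
theorem ramificationIndex_mul_inertiaDegree_eq_of_isDefectlessIn (O : ValuationSubring K)
    (hpow : ∀ ξ : L, ∃ c : K, algebraMap K L c = ξ ^ p) (O' : ValuationSubring L) (hO' : O'.comap (algebraMap K L) = O)
    (hdef : IsDefectlessIn K O L) :
    ramificationIndex K O' * inertiaDegree K O' = Module.finrank K L := by
  classical
  obtain ⟨s, hs, hsum⟩ := hdef
  have hs' : s = {O'} := by
    ext O''
    rw [hs, Finset.mem_singleton]
    constructor
    · exact fun h => eq_of_comap_eq O hpow O'' O' h hO'
    · rintro rfl; exact hO'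
  rw [hs', Finset.sum_singleton] at hsum
  exact hsum

/-! ## Valuation independence of the products `aᵢ bⱼ` (the value of a combination dominates each term) -/

section Independence

variable {M : Type u} [Field M] (OM : ValuationSubring M)

/-- **Valuation independence of the `aᵢ bⱼ`** (classical, Zariski–Samuel VI §11; the companion of the tree's
`linearIndependent_mul_of_valuation_of_residue`): with `F ⊆ M` a subfield, `H` a subgroup of the value group containing `|F^×|`,
`L₀` a subfield of the residue field containing the residues of `F ∩ M°`, `aᵢ ∈ M^×` with values in pairwise distinct cosets modulo
`H` and `bⱼ ∈ M°` with `L₀`-linearly independent residues, EVERY TERM of an `F`-combination `∑ cᵢⱼ aᵢ bⱼ` is bounded by the value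
of the sum: `v(cᵢⱼ aᵢ bⱼ) ≤ v(∑ cᵢⱼ aᵢ bⱼ)`.  (Each non-zero row sum `∑ⱼ cᵢⱼ bⱼ` has the value of its largest coefficient; the
non-zero `aᵢ ∑ⱼ cᵢⱼ bⱼ` have values in distinct cosets, so the value of the total is their maximum.)
[cite: Temkin2013, Section 2.1 (p. 9 of arXiv:0804.1554v3)] -/
theorem valuation_mul_le_valuation_sum (F : Subfield M)
    (H : Subgroup (ValuationSubring.ValueGroup OM)ˣ)
    (hH : ∀ c : M, c ∈ F → (hc : c ≠ 0) →
      Units.mk0 (OM.valuation c) ((Valuation.ne_zero_iff _).mpr hc) ∈ H)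
    (L₀ : Subfield (ResidueField OM))
    (hL : ∀ c : M, c ∈ F → (hc : c ∈ OM) → residue OM ⟨c, hc⟩ ∈ L₀)
    {e f : ℕ} (a : Fin e → M) (ha0 : ∀ i, a i ≠ 0)
    (hdist : ∀ i i', i ≠ i' →
      (Units.mk0 (OM.valuation (a i)) ((Valuation.ne_zero_iff _).mpr (ha0 i)))⁻¹ *
        Units.mk0 (OM.valuation (a i')) ((Valuation.ne_zero_iff _).mpr (ha0 i')) ∉ H)
    (b : Fin f → OM) (hb : LinearIndependent L₀ fun j => residue OM (b j))
    (g : Fin e × Fin f → F) (q : Fin e × Fin f) :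
    OM.valuation (((g q : F) : M) * (a q.1 * (b q.2 : M))) ≤
      OM.valuation (∑ r : Fin e × Fin f, ((g r : F) : M) * (a r.1 * (b r.2 : M))) := by
  classical
  by_cases hgq : ((g q : F) : M) = 0
  · rw [hgq, zero_mul, map_zero]; exact zero_le
  -- row sums
  let S : Fin e → M := fun i => ∑ j, ((g (i, j) : F) : M) * (b j : M)
  have hsumS : ∑ r : Fin e × Fin f, ((g r : F) : M) * (a r.1 * (b r.2 : M)) = ∑ i, a i * S i := by
    rw [Fintype.sum_prod_type]
    refine Finset.sum_congr rfl fun i _ => ?_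
    rw [Finset.mul_sum]
    exact Finset.sum_congr rfl fun j _ => by ring
  -- the value of a non-zero row sum is the value of its largest coefficient
  have hrow : ∀ i, (∃ j, ((g (i, j) : F) : M) ≠ 0) →
      ∃ j₀, ((g (i, j₀) : F) : M) ≠ 0 ∧ (∀ j, OM.valuation ((g (i, j) : F) : M) ≤ OM.valuation ((g (i, j₀) : F) : M)) ∧
        OM.valuation (S i) = OM.valuation ((g (i, j₀) : F) : M) := by
    rintro i ⟨j, hj⟩
    obtain ⟨j₀, -, hmax⟩ :=
      Finset.univ.exists_max_image (fun j => OM.valuation ((g (i, j) : F) : M)) ⟨j, Finset.mem_univ _⟩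
    have hc0 : ((g (i, j₀) : F) : M) ≠ 0 := by
      intro h0
      have h1 : OM.valuation ((g (i, j) : F) : M) ≤ OM.valuation ((g (i, j₀) : F) : M) :=
        hmax j (Finset.mem_univ _)
      rw [h0, map_zero, le_zero_iff, map_eq_zero] at h1
      exact hj h1
    have hvc0 : OM.valuation ((g (i, j₀) : F) : M) ≠ 0 := (Valuation.ne_zero_iff _).mpr hc0
    refine ⟨j₀, hc0, fun j' => hmax j' (Finset.mem_univ _), ?_⟩
    have hgO : ∀ j', ((g (i, j') : F) : M) / ((g (i, j₀) : F) : M) ∈ OM := fun j' => by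
      refine (OM.valuation_le_one_iff _).mp ?_
      rw [map_div₀]
      exact (div_le_one₀ (zero_lt_iff.mpr hvc0)).mpr (hmax j' (Finset.mem_univ _))
    let T : OM := ∑ j', (⟨((g (i, j') : F) : M) / ((g (i, j₀) : F) : M), hgO j'⟩ : OM) * b j'
    have hT : (T : M) = S i / ((g (i, j₀) : F) : M) := by
      change ((∑ j', (⟨((g (i, j') : F) : M) / ((g (i, j₀) : F) : M), hgO j'⟩ : OM) * b j' : OM) : M) = _
      rw [AddSubmonoidClass.coe_finsetSum]
      change ∑ j', ((g (i, j') : F) : M) / ((g (i, j₀) : F) : M) * (b j' : M) = _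
      rw [div_eq_mul_inv, Finset.sum_mul]
      exact Finset.sum_congr rfl fun j' _ => by ring
    have hresT : residue OM T ≠ 0 := by
      intro h0
      let l : Fin f → L₀ := fun j' => ⟨residue OM ⟨((g (i, j') : F) : M) / ((g (i, j₀) : F) : M), hgO j'⟩,
        hL _ (div_mem (g (i, j')).2 (g (i, j₀)).2) (hgO j')⟩
      have hrel : ∑ j', l j' • residue OM (b j') = 0 := by
        rw [← h0]
        change _ = residue OM (∑ j', _)
        rw [map_sum]
        refine Finset.sum_congr rfl fun j' _ => ?_
        rw [map_mul]
        rfl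
      have hl0 := (Fintype.linearIndependent_iff.mp hb) l hrel j₀
      have hl1 : l j₀ = 1 := Subtype.ext (by
        change residue OM ⟨((g (i, j₀) : F) : M) / ((g (i, j₀) : F) : M), _⟩ = 1
        have h1 : (⟨((g (i, j₀) : F) : M) / ((g (i, j₀) : F) : M), hgO j₀⟩ : OM) = 1 :=
          Subtype.ext (div_self hc0)
        rw [h1, map_one])
      rw [hl1] at hl0
      exact one_ne_zero hl0
    have hvT : OM.valuation (T : M) = 1 := by
      have h1 : T ∉ IsLocalRing.maximalIdeal OM := fun hm => hresT ((residue_eq_zero_iff _).mpr hm)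
      by_contra hne1
      exact h1 ((ValuationSubring.valuation_lt_one_iff OM T).mpr
        (lt_of_le_of_ne (OM.valuation_le_one T) hne1))
    rw [hT, map_div₀, div_eq_one_iff_eq hvc0] at hvT
    exact hvT
  -- the rows with a non-zero coefficient
  let s : Finset (Fin e) := Finset.univ.filter fun i => ∃ j, ((g (i, j) : F) : M) ≠ 0
  have hq1 : q.1 ∈ s := Finset.mem_filter.mpr ⟨Finset.mem_univ _, q.2, hgq⟩
  have hS0 : ∀ i, i ∉ s → S i = 0 := by
    intro i hi
    have h : ∀ j, ((g (i, j) : F) : M) = 0 := fun j => by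
      by_contra hj
      exact hi (Finset.mem_filter.mpr ⟨Finset.mem_univ _, j, hj⟩)
    simp only [S, h, zero_mul, Finset.sum_const_zero]
  have hsum_s : ∑ i, a i * S i = ∑ i ∈ s, a i * S i := by
    rw [← Finset.sum_filter_add_sum_filter_not Finset.univ (fun i => ∃ j, ((g (i, j) : F) : M) ≠ 0)]
    rw [Finset.sum_eq_zero (s := Finset.univ.filter fun i => ¬∃ j, ((g (i, j) : F) : M) ≠ 0) (fun i hi => by
      rw [hS0 i (fun hi' => (Finset.mem_filter.mp hi).2 (Finset.mem_filter.mp hi').2), mul_zero]),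
      add_zero]
  choose j₀ hj₀c hj₀max hj₀v using fun i : ↥s => hrow i (Finset.mem_filter.mp i.2).2
  obtain ⟨i₀, hi₀, hmax⟩ := s.exists_max_image (fun i => OM.valuation (a i * S i)) ⟨q.1, hq1⟩
  have hlt : ∀ i ∈ s \ {i₀}, OM.valuation (a i * S i) < OM.valuation (a i₀ * S i₀) := by
    intro i hi
    obtain ⟨his, hne⟩ := Finset.mem_sdiff.mp hi
    rw [Finset.mem_singleton] at hne
    refine lt_of_le_of_ne (hmax i his) fun heq => hdist i i₀ hne ?_
    have hci := hH _ (g (i, j₀ ⟨i, his⟩)).2 (hj₀c ⟨i, his⟩)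
    have hci₀ := hH _ (g (i₀, j₀ ⟨i₀, hi₀⟩)).2 (hj₀c ⟨i₀, hi₀⟩)
    have h2 : Units.mk0 (OM.valuation (a i)) ((Valuation.ne_zero_iff _).mpr (ha0 i)) *
        Units.mk0 (OM.valuation ((g (i, j₀ ⟨i, his⟩) : F) : M))
          ((Valuation.ne_zero_iff _).mpr (hj₀c ⟨i, his⟩)) =
        Units.mk0 (OM.valuation (a i₀)) ((Valuation.ne_zero_iff _).mpr (ha0 i₀)) *
          Units.mk0 (OM.valuation ((g (i₀, j₀ ⟨i₀, hi₀⟩) : F) : M))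
            ((Valuation.ne_zero_iff _).mpr (hj₀c ⟨i₀, hi₀⟩)) := by
      apply Units.ext
      simp only [Units.val_mul, Units.val_mk0, ← map_mul]
      rw [map_mul, map_mul, ← hj₀v ⟨i, his⟩, ← hj₀v ⟨i₀, hi₀⟩, ← map_mul, ← map_mul]
      exact heq
    have h3 : (Units.mk0 (OM.valuation (a i)) ((Valuation.ne_zero_iff _).mpr (ha0 i)))⁻¹ *
        Units.mk0 (OM.valuation (a i₀)) ((Valuation.ne_zero_iff _).mpr (ha0 i₀)) =
        Units.mk0 (OM.valuation ((g (i, j₀ ⟨i, his⟩) : F) : M))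
            ((Valuation.ne_zero_iff _).mpr (hj₀c ⟨i, his⟩)) *
          (Units.mk0 (OM.valuation ((g (i₀, j₀ ⟨i₀, hi₀⟩) : F) : M))
            ((Valuation.ne_zero_iff _).mpr (hj₀c ⟨i₀, hi₀⟩)))⁻¹ := by
      rw [inv_mul_eq_iff_eq_mul, ← mul_assoc, eq_mul_inv_iff_mul_eq]
      exact h2.symm
    rw [h3]
    exact H.mul_mem hci (H.inv_mem hci₀)
  have hv : OM.valuation (∑ i ∈ s, a i * S i) = OM.valuation (a i₀ * S i₀) := OM.valuation.map_sum_eq_of_lt hi₀ hlt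
  -- the term at `q` is bounded by its row, which is bounded by the maximal row
  have hbq : OM.valuation ((b q.2 : OM) : M) ≤ 1 := OM.valuation_le_one _
  calc OM.valuation (((g q : F) : M) * (a q.1 * (b q.2 : M)))
      = OM.valuation (a q.1) * (OM.valuation ((g q : F) : M) * OM.valuation ((b q.2 : OM) : M)) := by
        rw [map_mul, map_mul, mul_left_comm]
    _ ≤ OM.valuation (a q.1) * (OM.valuation ((g (q.1, j₀ ⟨q.1, hq1⟩) : F) : M) * 1) := by
        refine mul_le_mul_right (mul_le_mul' (hj₀max ⟨q.1, hq1⟩ q.2) hbq) _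
    _ = OM.valuation (a q.1 * S q.1) := by rw [mul_one, ← hj₀v ⟨q.1, hq1⟩, map_mul]
    _ ≤ OM.valuation (a i₀ * S i₀) := hmax q.1 hq1
    _ = OM.valuation (∑ r : Fin e × Fin f, ((g r : F) : M) * (a r.1 * (b r.2 : M))) := by rw [hsumS, hsum_s, hv]

end Independence

end Summit.ResolutionOfSingularities.ResolutionOfSingularities.Theorems.RadicialJung.CleanModels

end
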